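import Summits.NavierStokesRegularity.NavierStokesRegularity.Theorems.AdaptedFrequencyEnstrophyDensity
import Literature.Analysis.FluidPDE.EnstrophyGronwall
import Literature.Analysis.FluidPDE.EnergyUniqueness
import HarnessLib

/-!
# Pointwise bounds for the enstrophy density `‖ω‖²` and `L‖ω‖²` from `C³` bounds on `u`
# (route `AdaptedFrequency`, item `TangentFlowTransfer`, stmt-NavierStokesRegularity-10494)

Helper file (all results proved). To differentiate the adapted enstrophies
`H_k(t) = ∫ ‖curl w_k(t)‖² g_k(t)` of the blow-up sequence under the integral sign with bounds
uniform in `k` (`hasDerivAt_integral_mul_kernel_of_bounds`), one needs pointwise bounds on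
`q = ‖curl u‖²`, `Dq`, `Δq`, `∂ₜq` and `u` in terms of `sup (‖u‖, ‖Du‖, ‖D²u‖, ‖D³u‖)` only.
They follow from `curl = curlCLM ∘ D` (`norm_curl_le`, `norm_fderiv_curl_le`),
`D‖ω‖² = 2⟪ω, Dω·⟫`, `Δ‖ω‖² = 2⟪Δω, ω⟫ + 2|Dω|²` (`laplacian_inner_self_eq`) and, for the time
derivative, the enstrophy density identity `∂ₜq = −Dq·u + νΔq + 2⟪ω, Du ω⟫ − 2ν|Dω|²`
(`opL_norm_curl_sq_eq`): `exists_enstrophyDensity_bounds` produces one constant `B(ν, M)`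
working for every classical solution obeying the `C³` bound `M`.
-/

noncomputable section

open MeasureTheory Set Function Filter TopologicalSpace Metric
open scoped Topology InnerProductSpace RealInnerProductSpace Laplacian

namespace Summit.NavierStokesRegularity.NavierStokesRegularity.Theorems

open Literature.Analysis Literature.Analysis.FluidPDE

local notation "ℝ³" => EuclideanSpace ℝ (Fin 3)

/-- `‖D²(curl v)(x)‖ ≤ κ ‖D³v(x)‖` for `v ∈ C³`, `κ = ‖curlCLM‖` (`curl v = curlCLM ∘ Dv`).
[folklore] -/
theorem norm_iteratedFDeriv_two_curl_le {v : ℝ³ → ℝ³} (hv : ContDiff ℝ 3 v) (x : ℝ³) :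
    ‖iteratedFDeriv ℝ 2 (curl v) x‖ ≤ ‖curlCLM‖ * ‖iteratedFDeriv ℝ 3 v x‖ := by
  rw [curl_eq_curlCLM_comp]
  have hDv : ContDiff ℝ 2 (fderiv ℝ v) := hv.fderiv_right (m := 2) (by norm_num)
  have h := curlCLM.norm_iteratedFDeriv_comp_left (x := x) (n := 2) hDv.contDiffAt (mod_cast le_rfl)
  rw [norm_iteratedFDeriv_fderiv] at h
  exact h

/-- `‖Δ(curl v)(x)‖ ≤ 3κ ‖D³v(x)‖` for `v ∈ C³`. [folklore] -/
theorem norm_laplacian_curl_le {v : ℝ³ → ℝ³} (hv : ContDiff ℝ 3 v) (x : ℝ³) :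
    ‖(Δ (curl v)) x‖ ≤ 3 * (‖curlCLM‖ * ‖iteratedFDeriv ℝ 3 v x‖) := by
  have h1 := norm_laplacian_le (curl v) x
  rw [finrank_euclideanSpace_fin] at h1
  refine h1.trans ?_
  have h2 : ‖fderiv ℝ (fderiv ℝ (curl v)) x‖ = ‖iteratedFDeriv ℝ 2 (curl v) x‖ := by
    rw [← norm_iteratedFDeriv_fderiv, norm_iteratedFDeriv_one]
  rw [h2]
  push_cast
  exact mul_le_mul_of_nonneg_left (norm_iteratedFDeriv_two_curl_le hv x) (by norm_num)

/-- `D‖ω‖²(x) h = 2⟪ω(x), Dω(x) h⟫` for `ω = curl v`, `v ∈ C²`; hence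
`‖D‖ω‖²(x)‖ ≤ 2 ‖ω(x)‖ ‖Dω(x)‖`. [folklore] -/
theorem norm_fderiv_norm_curl_sq_le {v : ℝ³ → ℝ³} (hv : ContDiff ℝ 2 v) (x : ℝ³) :
    ‖fderiv ℝ (fun y => ‖curl v y‖ ^ 2) x‖ ≤ 2 * ‖curl v x‖ * ‖fderiv ℝ (curl v) x‖ := by
  have hω : ContDiff ℝ 1 (curl v) := contDiff_curl (n := 1) (by exact_mod_cast hv)
  have hd : DifferentiableAt ℝ (curl v) x := (hω.differentiable one_ne_zero) x
  have hsq : (fun y => ‖curl v y‖ ^ 2) = fun y => ⟪curl v y, curl v y⟫ := by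
    funext y; rw [real_inner_self_eq_norm_sq]
  rw [hsq]
  refine ContinuousLinearMap.opNorm_le_bound _ (by positivity) fun h => ?_
  rw [fderiv_inner_apply ℝ hd hd]
  calc ‖⟪curl v x, fderiv ℝ (curl v) x h⟫ + ⟪fderiv ℝ (curl v) x h, curl v x⟫‖
      ≤ ‖⟪curl v x, fderiv ℝ (curl v) x h⟫‖ + ‖⟪fderiv ℝ (curl v) x h, curl v x⟫‖ :=
        norm_add_le _ _
    _ ≤ ‖curl v x‖ * ‖fderiv ℝ (curl v) x h‖ + ‖fderiv ℝ (curl v) x h‖ * ‖curl v x‖ :=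
        add_le_add (norm_inner_le_norm _ _) (norm_inner_le_norm _ _)
    _ ≤ ‖curl v x‖ * (‖fderiv ℝ (curl v) x‖ * ‖h‖) +
          (‖fderiv ℝ (curl v) x‖ * ‖h‖) * ‖curl v x‖ := by
        gcongr <;> exact ContinuousLinearMap.le_opNorm _ _
    _ = 2 * ‖curl v x‖ * ‖fderiv ℝ (curl v) x‖ * ‖h‖ := by ring

/-- `Δ‖ω‖²(x) = 2⟪Δω(x), ω(x)⟫ + 2|Dω(x)|²` for `ω = curl v`, `v ∈ C³`; hence
`|Δ‖ω‖²(x)| ≤ 2 ‖Δω(x)‖ ‖ω(x)‖ + 6 ‖Dω(x)‖²`. [folklore] -/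
theorem abs_laplacian_norm_curl_sq_le {v : ℝ³ → ℝ³} (hv : ContDiff ℝ 3 v) (x : ℝ³) :
    |(Δ fun y => ‖curl v y‖ ^ 2) x| ≤
      2 * ‖(Δ (curl v)) x‖ * ‖curl v x‖ + 6 * ‖fderiv ℝ (curl v) x‖ ^ 2 := by
  have hω : ContDiff ℝ 2 (curl v) := contDiff_curl (n := 2) (by exact_mod_cast hv)
  have hsq : (fun y => ‖curl v y‖ ^ 2) = fun y => ⟪curl v y, curl v y⟫ := by
    funext y; rw [real_inner_self_eq_norm_sq]
  rw [hsq, laplacian_inner_self_eq hω x]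
  have h1 : |⟪(Δ (curl v)) x, curl v x⟫| ≤ ‖(Δ (curl v)) x‖ * ‖curl v x‖ :=
    abs_real_inner_le_norm _ _
  have h2 : frobeniusNormSq (fderiv ℝ (curl v) x) ≤ 3 * ‖fderiv ℝ (curl v) x‖ ^ 2 :=
    frobeniusNormSq_le_three_mul _
  have h3 : 0 ≤ frobeniusNormSq (fderiv ℝ (curl v) x) := frobeniusNormSq_nonneg _
  have h4 : |2 * ⟪(Δ (curl v)) x, curl v x⟫| ≤ 2 * (‖(Δ (curl v)) x‖ * ‖curl v x‖) := by
    rw [abs_mul, abs_of_pos (two_pos : (0 : ℝ) < 2)]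
    exact mul_le_mul_of_nonneg_left h1 two_pos.le
  have h5 : |2 * frobeniusNormSq (fderiv ℝ (curl v) x)| ≤ 6 * ‖fderiv ℝ (curl v) x‖ ^ 2 := by
    rw [abs_of_nonneg (by positivity)]
    linarith
  refine (abs_add_le _ _).trans ?_
  linarith

variable {S : Set ℝ} {ν : ℝ} {u : ℝ → ℝ³ → ℝ³} {p : ℝ → ℝ³ → ℝ}

/-- **Time derivative of the enstrophy density from the vorticity equation**: for a classical
solution, `∂ₜ‖ω‖² = 2⟪ω, Du ω⟫ − 2ν|Dω|² − D‖ω‖²·u + νΔ‖ω‖²`, hence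
`|∂ₜ‖ω‖²| ≤ 2‖ω‖²‖Du‖ + 6|ν|‖Dω‖² + ‖D‖ω‖²‖ ‖u‖ + |ν| |Δ‖ω‖²|`. [folklore] -/
theorem abs_timeDerivWithin_norm_curl_sq_le (h : IsClassicalNSSolutionOn S ν 0 u p)
    (hS : UniqueDiffOn ℝ S) {t : ℝ} (ht : t ∈ S) (x : ℝ³) :
    |timeDerivWithin S (fun s y => ‖curl (u s) y‖ ^ 2) t x| ≤
      2 * ‖curl (u t) x‖ ^ 2 * ‖fderiv ℝ (u t) x‖ + 6 * |ν| * ‖fderiv ℝ (curl (u t)) x‖ ^ 2 +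
        ‖fderiv ℝ (fun y => ‖curl (u t) y‖ ^ 2) x‖ * ‖u t x‖ +
        |ν| * |(Δ fun y => ‖curl (u t) y‖ ^ 2) x| := by
  have h1 := opL_norm_curl_sq_eq h hS ht x
  have h2 : timeDerivWithin S (fun s y => ‖curl (u s) y‖ ^ 2) t x =
      2 * ⟪curl (u t) x, fderiv ℝ (u t) x (curl (u t) x)⟫ -
        2 * ν * frobeniusNormSq (fderiv ℝ (curl (u t)) x) -
        fderiv ℝ (fun y => ‖curl (u t) y‖ ^ 2) x (u t x) +
        ν * (Δ fun y => ‖curl (u t) y‖ ^ 2) x := by linarith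
  rw [h2]
  have ha : |⟪curl (u t) x, fderiv ℝ (u t) x (curl (u t) x)⟫| ≤
      ‖curl (u t) x‖ ^ 2 * ‖fderiv ℝ (u t) x‖ := by
    refine (abs_real_inner_le_norm _ _).trans ?_
    have := ContinuousLinearMap.le_opNorm (fderiv ℝ (u t) x) (curl (u t) x)
    calc ‖curl (u t) x‖ * ‖fderiv ℝ (u t) x (curl (u t) x)‖
        ≤ ‖curl (u t) x‖ * (‖fderiv ℝ (u t) x‖ * ‖curl (u t) x‖) := by gcongr
      _ = ‖curl (u t) x‖ ^ 2 * ‖fderiv ℝ (u t) x‖ := by ring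
  have hb : |frobeniusNormSq (fderiv ℝ (curl (u t)) x)| ≤ 3 * ‖fderiv ℝ (curl (u t)) x‖ ^ 2 := by
    rw [abs_of_nonneg (frobeniusNormSq_nonneg _)]
    exact frobeniusNormSq_le_three_mul _
  have hc : |fderiv ℝ (fun y => ‖curl (u t) y‖ ^ 2) x (u t x)| ≤
      ‖fderiv ℝ (fun y => ‖curl (u t) y‖ ^ 2) x‖ * ‖u t x‖ := by
    rw [← Real.norm_eq_abs]
    exact ContinuousLinearMap.le_opNorm _ _
  calc |2 * ⟪curl (u t) x, fderiv ℝ (u t) x (curl (u t) x)⟫ -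
          2 * ν * frobeniusNormSq (fderiv ℝ (curl (u t)) x) -
          fderiv ℝ (fun y => ‖curl (u t) y‖ ^ 2) x (u t x) +
          ν * (Δ fun y => ‖curl (u t) y‖ ^ 2) x|
      ≤ |2 * ⟪curl (u t) x, fderiv ℝ (u t) x (curl (u t) x)⟫| +
          |2 * ν * frobeniusNormSq (fderiv ℝ (curl (u t)) x)| +
          |fderiv ℝ (fun y => ‖curl (u t) y‖ ^ 2) x (u t x)| +
          |ν * (Δ fun y => ‖curl (u t) y‖ ^ 2) x| := by
        refine (abs_add_le _ _).trans (add_le_add ((abs_sub _ _).trans (add_le_add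
          (abs_sub _ _) le_rfl)) le_rfl)
    _ = 2 * |⟪curl (u t) x, fderiv ℝ (u t) x (curl (u t) x)⟫| +
          2 * |ν| * |frobeniusNormSq (fderiv ℝ (curl (u t)) x)| +
          |fderiv ℝ (fun y => ‖curl (u t) y‖ ^ 2) x (u t x)| +
          |ν| * |(Δ fun y => ‖curl (u t) y‖ ^ 2) x| := by
        rw [abs_mul, abs_two, abs_mul, abs_mul, abs_two, abs_mul]
    _ ≤ 2 * (‖curl (u t) x‖ ^ 2 * ‖fderiv ℝ (u t) x‖) +
          2 * |ν| * (3 * ‖fderiv ℝ (curl (u t)) x‖ ^ 2) +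
          ‖fderiv ℝ (fun y => ‖curl (u t) y‖ ^ 2) x‖ * ‖u t x‖ +
          |ν| * |(Δ fun y => ‖curl (u t) y‖ ^ 2) x| := by
        gcongr
    _ = _ := by ring

/-- **Uniform bounds for the enstrophy density.** For every viscosity `ν` and every `M ≥ 0`
there is `B = B(ν, M)` such that, for every classical solution `(u, p)` of the unforced
Navier–Stokes system on a time set `S` of unique differentiability obeying
`‖u‖, ‖Du‖, ‖D²u‖, ‖D³u‖ ≤ M` on `S × ℝ³`, the enstrophy density `q = ‖curl u‖²` obeys
`|q|, ‖Dq‖, |Δq|, |∂ₜq| ≤ B` (and `‖u‖ ≤ B`) on `S × ℝ³` — the hypothesis `hbd` of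
`hasDerivAt_integral_mul_kernel_of_bounds`, with a constant independent of the solution. [folklore] -/
theorem exists_enstrophyDensity_bounds (ν M : ℝ) :
    ∃ B : ℝ, ∀ ⦃S : Set ℝ⦄ ⦃u : ℝ → ℝ³ → ℝ³⦄ ⦃p : ℝ → ℝ³ → ℝ⦄,
      IsClassicalNSSolutionOn S ν 0 u p → UniqueDiffOn ℝ S →
      (∀ t ∈ S, ∀ x, ‖u t x‖ ≤ M ∧ ‖fderiv ℝ (u t) x‖ ≤ M ∧ ‖iteratedFDeriv ℝ 2 (u t) x‖ ≤ M ∧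
        ‖iteratedFDeriv ℝ 3 (u t) x‖ ≤ M) →
      ∀ t ∈ S, ∀ x, |‖curl (u t) x‖ ^ 2| ≤ B ∧
        ‖fderiv ℝ (fun y => ‖curl (u t) y‖ ^ 2) x‖ ≤ B ∧
        |(Δ fun y => ‖curl (u t) y‖ ^ 2) x| ≤ B ∧
        |timeDerivWithin S (fun s y => ‖curl (u s) y‖ ^ 2) t x| ≤ B ∧ ‖u t x‖ ≤ B := by
  have hκ0 : 0 ≤ ‖curlCLM‖ := norm_nonneg curlCLM
  -- `a = κ |M|` (`κ = ‖curlCLM‖`) bounds `‖ω‖`, `‖Dω‖` and `‖D²ω‖`; `|M|` guards against `M < 0`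
  set m : ℝ := |M| with hm
  have hm0 : 0 ≤ m := abs_nonneg _
  set a : ℝ := ‖curlCLM‖ * m with ha
  have ha0 : 0 ≤ a := mul_nonneg hκ0 hm0
  refine ⟨m + a ^ 2 + 2 * a * a + (6 * a * a + 6 * a ^ 2) +
    (2 * a ^ 2 * m + 6 * |ν| * a ^ 2 + 2 * a * a * m + |ν| * (6 * a * a + 6 * a ^ 2)), ?_⟩
  intro S u p hcl hS hb t ht x
  obtain ⟨h0, h1, h2, h3⟩ := hb t ht x
  have hMm : M ≤ m := le_abs_self M
  have h0' : ‖u t x‖ ≤ m := h0.trans hMm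
  have h1' : ‖fderiv ℝ (u t) x‖ ≤ m := h1.trans hMm
  have h2' : ‖iteratedFDeriv ℝ 2 (u t) x‖ ≤ m := h2.trans hMm
  have h3' : ‖iteratedFDeriv ℝ 3 (u t) x‖ ≤ m := h3.trans hMm
  have hu3 : ContDiff ℝ 3 (u t) := contDiff_infty.1 (hcl.contDiff_velocity ht) 3
  have hu2 : ContDiff ℝ 2 (u t) := hu3.of_le (by norm_num)
  -- the three vorticity bounds
  have hω : ‖curl (u t) x‖ ≤ a :=
    (norm_curl_le (u t) x).trans (mul_le_mul_of_nonneg_left h1' hκ0)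
  have hDω : ‖fderiv ℝ (curl (u t)) x‖ ≤ a :=
    (norm_fderiv_curl_le hu2 x).trans (mul_le_mul_of_nonneg_left h2' hκ0)
  have hΔω : ‖(Δ (curl (u t))) x‖ ≤ 3 * a :=
    (norm_laplacian_curl_le hu3 x).trans (by
      refine mul_le_mul_of_nonneg_left (mul_le_mul_of_nonneg_left h3' hκ0) (by norm_num))
  have hω0 : 0 ≤ ‖curl (u t) x‖ := norm_nonneg _
  have hDω0 : 0 ≤ ‖fderiv ℝ (curl (u t)) x‖ := norm_nonneg _
  -- the density bounds
  have hq : |‖curl (u t) x‖ ^ 2| ≤ a ^ 2 := by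
    rw [abs_of_nonneg (sq_nonneg _)]
    exact pow_le_pow_left₀ hω0 hω 2
  have hDq : ‖fderiv ℝ (fun y => ‖curl (u t) y‖ ^ 2) x‖ ≤ 2 * a * a := by
    refine (norm_fderiv_norm_curl_sq_le hu2 x).trans ?_
    gcongr
  have hΔq : |(Δ fun y => ‖curl (u t) y‖ ^ 2) x| ≤ 6 * a * a + 6 * a ^ 2 := by
    refine (abs_laplacian_norm_curl_sq_le hu3 x).trans ?_
    have e1 : 2 * ‖(Δ (curl (u t))) x‖ * ‖curl (u t) x‖ ≤ 2 * (3 * a) * a := by gcongr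
    have e2 : 6 * ‖fderiv ℝ (curl (u t)) x‖ ^ 2 ≤ 6 * a ^ 2 := by gcongr
    linarith
  have hν0 : 0 ≤ |ν| := abs_nonneg ν
  have htq : |timeDerivWithin S (fun s y => ‖curl (u s) y‖ ^ 2) t x| ≤
      2 * a ^ 2 * m + 6 * |ν| * a ^ 2 + 2 * a * a * m + |ν| * (6 * a * a + 6 * a ^ 2) := by
    refine (abs_timeDerivWithin_norm_curl_sq_le hcl hS ht x).trans ?_
    have e1 : 2 * ‖curl (u t) x‖ ^ 2 * ‖fderiv ℝ (u t) x‖ ≤ 2 * a ^ 2 * m := by gcongr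
    have e2 : 6 * |ν| * ‖fderiv ℝ (curl (u t)) x‖ ^ 2 ≤ 6 * |ν| * a ^ 2 := by gcongr
    have e3 : ‖fderiv ℝ (fun y => ‖curl (u t) y‖ ^ 2) x‖ * ‖u t x‖ ≤ 2 * a * a * m :=
      mul_le_mul hDq h0' (norm_nonneg _) (by positivity)
    have e4 : |ν| * |(Δ fun y => ‖curl (u t) y‖ ^ 2) x| ≤ |ν| * (6 * a * a + 6 * a ^ 2) :=
      mul_le_mul_of_nonneg_left hΔq hν0
    linarith
  have hsum0 : 0 ≤ 2 * a ^ 2 * m + 6 * |ν| * a ^ 2 + 2 * a * a * m + |ν| * (6 * a * a + 6 * a ^ 2) := by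
    positivity
  have n1 : 0 ≤ a ^ 2 := sq_nonneg a
  have n2 : 0 ≤ 2 * a * a := by positivity
  have n3 : 0 ≤ 6 * a * a + 6 * a ^ 2 := by positivity
  refine ⟨?_, ?_, ?_, ?_, ?_⟩
  · linarith
  · linarith
  · linarith
  · linarith
  · linarith

end Summit.NavierStokesRegularity.NavierStokesRegularity.Theorems

end
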